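import Mathlib
import HarnessLib
import Literature.Analysis.FluidPDE.HydrodynamicImpulseBalance
import Literature.Analysis.FluidPDE.ForcedFourierForceData
import Literature.Analysis.FluidPDE.ClayForceTimeShift
import Literature.Analysis.FluidPDE.LeiZhang2011Proofs
import Literature.Analysis.FluidPDE.LagrangianTimeDerivativeTools
import Summits.NavierStokesRegularity.FluidComputer.PalasekTowerStageSmoothness
import Summits.NavierStokesRegularity.NavierStokesRegularity.Theorems.HeredityAtOne.Negative.CapStratumIntegrable

/-!
# The impulse ledger of a registered stage (Saffman (3.2.9) on the register, modulo one first-moment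
# vorticity-decay hypothesis): a signed swirl-free readout slice needs a push of POSITIVE axial mean

Cell `ns-blowup`, seat `ns-blowup-fc-prover-3` (g8; prover, GROUP E re-point; bears_on LADDER-NS N1, route
`PalasekTowerBreakdown`, crux `HeredityAtOne` = item stmt-NavierStokesRegularity-19249, NEGATIVE LANE — supports
only). LABEL: KERNEL bookkeeping (theorems only; no definition, no named fact; nothing asserted about the crux).

THE POINT. g7 of this seat (`CapStratumIntegrable.lean`) showed by kinematics that a single-signed swirl-free readout
slice of a registered stage carries STRICTLY POSITIVE axial impulse `½ ∫ r²(ω_θ/r) > 0`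
(`integral_cylRadius_sq_mul_angVortQuot_pos_of_signedNoSwirlSlice`) and left the dynamics behind it — Saffman's
impulse law (3.2.9), `dI/dt = ∫ f dx` — as an untyped READING. That law is now the tree theorem
`IsClassicalNSSolutionOn.integral_cross_vorticity_sub_eq` / `…integral_swirl_vorticity_sub_eq`
(`Literature/Analysis/FluidPDE/HydrodynamicImpulseBalance.lean`, this seat). This file runs it ON THE REGISTER:

* `impulse_hypotheses` — for EVERY registered stage `s : Stage ν R S m k` (`ν > 0`; any rates, schedule, margins,
  level) and every readout `j ≤ k`, under ONE decay hypothesis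
  **D(j)**: `(1 + |x|)·(|ω| + |∇ω| + |Δω|)(t, x) ≤ G(x)` for some integrable `G`, all `t ∈ [0, τ_j]`, all `x`
  (a first spatial moment of the vorticity and of two of its derivatives, uniformly on the slab), every other
  hypothesis of the Literature theorem is DISCHARGED from the register: finite energy and enstrophy (Tao's class,
  `Stage.hasBoundedSobolevNormsOn`), `Δu = −curl ω ∈ L¹`, the force's Schwartz majorant (`S.force_decay`), and the
  majorant of `x × ∂ₜω` (from `∂ₜω = νΔω − (u·∇)ω + (ω·∇)u + curl f`, the register's speed ceiling `c₂ Y_k` and the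
  gradient ceiling of Tao's class);
* `integral_cross_curl_slice_eq_two_smul` — the IMPULSE LEDGER `∫ x × ω(τ_j, x) dx = 2 ∫₀^{τ_j} ∫ S.f dx dt`: the
  Clay datum opens the ledger at zero impulse and only the spatial mean of the design's force moves it;
  `integral_swirl_curl_slice_eq_two_mul` — the axial component `∫ swirl ω(τ_j) = 2 ∫₀^{τ_j} ∫ f₃`;
* `integral_force_axial_pos_of_signedNoSwirlSlice` — **a registered stage whose `τ_j`-slice is signed swirl-free
  was pushed with POSITIVE total axial mean, `0 < ∫₀^{τ_j} ∫ f₃ dx dt`** (under D(j)); contrapositives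
  `not_signedNoSwirlSlice_of_integral_force_axial_nonpos` / `_of_zeroMean` (zero-mean, e.g. `curl`-type, pushes
  never produce a signed swirl-free readout slice). The stratum corollaries for item 19249's split live in the
  sequel `CapStratumImpulseBalance.lean`.

D(j) is a property of the registered FLOW (expected of every smooth forced flow from Schwartz data, but NOT supplied
by the register — `Stage` records finite energy and Tao's `H^∞` class, no spatial weights — and not proved here);
every statement carries it as an explicit hypothesis. The velocity is never assumed integrable (`∫ x × ω ≠ 0` forces
the `O(|x|⁻³)` tail). WHAT THIS IS NOT: not Navier–Stokes evidence, no verdict change on item 19249; no stage, slice,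
flow or design is constructed.

References: P. G. Saffman, *Vortex Dynamics* (1992) §3.2 (3.2.8)–(3.2.15) [cite: Saffman1992, §3.2];
A. J. Majda, A. L. Bertozzi (2002) §1.7 Prop. 1.12, §2.4 (2.110) [cite: MajdaBertozziCUP2002, §1.7 Prop. 1.12];
T. Tao, Anal. PDE 6 (2013) Cor. 11.1 [cite: Tao2011, Cor. 11.1]; S. Palasek, arXiv:2605.13827 §3.3–§4
[cite: Palasek2026ElementaryModel, §4].
-/

noncomputable section

namespace Summit.NavierStokesRegularity.HeredityAtOneImpulseBalance

open Set MeasureTheory Filter Function InnerProductSpace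
open scoped RealInnerProductSpace ContDiff Laplacian Topology
open Literature.Analysis.FluidPDE
open Summit.NavierStokesRegularity.FluidComputer
open Summit.NavierStokesRegularity.FluidComputer.PalasekTowerClayBridge
open Summit.NavierStokesRegularity.NavierStokesRegularity
open Summit.NavierStokesRegularity.HeredityAtOneNoSwirlCap
open Summit.NavierStokesRegularity.HeredityAtOneNoSwirlStratum
open Summit.NavierStokesRegularity.HeredityAtOneImpulse

/-! ## §1 Plumbing: the slab, the force majorants, pointwise bounds -/

section Plumbing

variable {R : TowerRates}

/-- The slab `[0, τ_k]` of a schedule is a set of unique differentiability. [folklore] -/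
theorem uniqueDiffOn_slab (S : Schedule R) (k : ℕ) : UniqueDiffOn ℝ (Icc 0 (S.τ k)) :=
  uniqueDiffOn_Icc (S.τ_pos k)

/-- The slab `[0, τ_k]` lies in the closure of its interior (it is a non-degenerate interval). [folklore] -/
theorem slab_subset_closure_interior (S : Schedule R) (k : ℕ) :
    Icc 0 (S.τ k) ⊆ closure (interior (Icc 0 (S.τ k))) := by
  rw [interior_Icc, closure_Ioo (S.τ_pos k).ne]

/-- The schedule's force is jointly smooth on every slab `[0, τ_k]`. [folklore] -/
theorem isSmoothSpaceTimeOn_force_slab (S : Schedule R) (k : ℕ) :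
    IsSmoothSpaceTimeOn (Icc 0 (S.τ k)) S.f :=
  (show IsSmoothSpaceTimeOn (Ici 0) S.f from S.force_smooth).mono Icc_subset_Ici_self

/-- **Uniform Schwartz bounds for the force slices on a slab** (Fefferman (5) ⇒ `(1+|x|)^K ‖Dⁿ(f t)(x)‖ ≤ C` for
all `t ∈ [0, τ_k]`, all `x`). [cite: Tao2011, Def. 1.1 (p. 3)] -/
theorem force_slice_bound (S : Schedule R) (k n K : ℕ) :
    ∃ C : ℝ, 0 ≤ C ∧ ∀ t ∈ Icc 0 (S.τ k), ∀ x, (1 + ‖x‖) ^ K * ‖iteratedFDeriv ℝ n (S.f t) x‖ ≤ C :=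
  (S.force_decay.hasUniformRapidDecayOn_Icc S.force_smooth (S.τ_pos k)).exists_uniform_slice_bound
    (isSmoothSpaceTimeOn_force_slab S k) (S.τ_pos k) n K

/-- `(1 + |x|)⁻⁴` is integrable on `ℝ³`. [folklore] -/
theorem integrable_one_add_norm_neg_four :
    Integrable fun x : EuclideanSpace ℝ (Fin 3) => (1 + ‖x‖) ^ (-(4 : ℝ)) :=
  integrable_one_add_norm (by rw [finrank_euclideanSpace, Fintype.card_fin]; norm_num)

/-- `‖curl v x‖ ≤ ‖curlCLM‖ ‖Dv(x)‖` (`curl = curlCLM ∘ D`). [folklore] -/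
theorem norm_curl_le_opNorm_mul (v : EuclideanSpace ℝ (Fin 3) → EuclideanSpace ℝ (Fin 3))
    (x : EuclideanSpace ℝ (Fin 3)) : ‖curl v x‖ ≤ ‖curlCLM‖ * ‖fderiv ℝ v x‖ := by
  rw [curl_eq_curlCLM]
  exact curlCLM.le_opNorm _

end Plumbing

/-! ## §2 The hypotheses of the impulse law, discharged from the register (modulo D) -/

section Register

variable {ν : ℝ} {R : TowerRates} {S : Schedule R} {m : Margins R} {k : ℕ}

/-- Every slice of a stage with `ν > 0` has `‖u‖·‖Du‖ ∈ L¹` (finite energy and finite enstrophy: Tao's class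
`Stage.hasBoundedSobolevNormsOn`, `n = 1`, and `ab ≤ a² + b²`). [cite: Tao2011, Cor. 11.1] -/
theorem integrable_norm_mul_norm_fderiv_slice (hν : 0 < ν) (s : Stage ν R S m k) {t : ℝ}
    (ht : t ∈ Icc 0 (S.τ k)) : Integrable fun x => ‖s.u t x‖ * ‖fderiv ℝ (s.u t) x‖ := by
  obtain ⟨C, hC⟩ := s.hasBoundedSobolevNormsOn hν 1
  have hsm : ContDiff ℝ ∞ (s.u t) := s.contDiff_slice ht
  have hc1 : Continuous (iteratedFDeriv ℝ 1 (s.u t)) := hsm.continuous_iteratedFDeriv (by simp)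
  have hD2 : Integrable fun x => ‖iteratedFDeriv ℝ 1 (s.u t) x‖ ^ 2 :=
    integrable_sq_norm_of_lintegral_lt_top hc1 ((hC t ht).trans_lt ENNReal.coe_lt_top)
  have hD2' : Integrable fun x => ‖fderiv ℝ (s.u t) x‖ ^ 2 := by
    refine hD2.congr (Eventually.of_forall fun x => ?_)
    simp only
    rw [← norm_iteratedFDeriv_fderiv (n := 0), norm_iteratedFDeriv_zero]
  have h2 := integrable_norm_sq_slice s ht
  refine (h2.add hD2').mono' ?_ (Eventually.of_forall fun x => ?_)
  · exact (hsm.continuous.norm.mul (hsm.continuous_fderiv (by simp)).norm).aestronglyMeasurable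
  · rw [Real.norm_of_nonneg (by positivity)]
    simp only [Pi.add_apply]
    nlinarith [sq_nonneg (‖s.u t x‖ - ‖fderiv ℝ (s.u t) x‖), norm_nonneg (s.u t x),
      norm_nonneg (fderiv ℝ (s.u t) x)]

/-- **The vorticity rate of a stage, pointwise**: `∂ₜω = νΔω − (u·∇)ω + (ω·∇)u + curl f` on the slab (tree:
`curl_timeDerivWithin` and `curl_timeDerivWithin_eq`). [cite: MajdaBertozziCUP2002, §2.4 eq. (2.110)] -/
theorem timeDerivWithin_vorticity_eq (s : Stage ν R S m k) {t : ℝ} (ht : t ∈ Icc 0 (S.τ k))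
    (x : EuclideanSpace ℝ (Fin 3)) :
    timeDerivWithin (Icc 0 (S.τ k)) (vorticity s.u) t x =
      ν • (Δ (curl (s.u t))) x - convect (s.u t) (curl (s.u t)) x + convect (curl (s.u t)) (s.u t) x
        + curl (S.f t) x := by
  rw [← s.classical.smooth_velocity.curl_timeDerivWithin (uniqueDiffOn_slab S k)
    (slab_subset_closure_interior S k) ht x,
    s.classical.curl_timeDerivWithin_eq (uniqueDiffOn_slab S k) ht x]

/-- **All hypotheses of the impulse law hold for a registered stage under D(j)** (`ν > 0`, `j ≤ k`): a Schwartz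
majorant `F` of the force slices, an integrable majorant `g` of `x × ∂ₜω` on `[0, τ_j]`, `‖u‖², ‖u‖‖Du‖, Δu ∈ L¹`
at every time, and integrable impulse densities `x × ω`. [cite: Saffman1992, §3.2 eq. (3.2.9)] -/
theorem impulse_hypotheses (hν : 0 < ν) (s : Stage ν R S m k) {j : ℕ} (hj : j ≤ k)
    {G : EuclideanSpace ℝ (Fin 3) → ℝ} (hG : Integrable G)
    (hD : ∀ t ∈ Icc 0 (S.τ j), ∀ x, (1 + ‖x‖) * (‖curl (s.u t) x‖ + ‖fderiv ℝ (curl (s.u t)) x‖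
      + ‖(Δ (curl (s.u t))) x‖) ≤ G x) :
    ∃ F g : EuclideanSpace ℝ (Fin 3) → ℝ, Integrable F ∧ Integrable g ∧
      (∀ t ∈ Icc 0 (S.τ j), ∀ x, ‖S.f t x‖ ≤ F x) ∧
      (∀ t ∈ Icc 0 (S.τ j), ∀ x,
        ‖cross x (timeDerivWithin (Icc 0 (S.τ k)) (vorticity s.u) t x)‖ ≤ g x) ∧
      (∀ t ∈ Icc 0 (S.τ j), Integrable fun x => ‖s.u t x‖ ^ 2) ∧
      (∀ t ∈ Icc 0 (S.τ j), Integrable fun x => ‖s.u t x‖ * ‖fderiv ℝ (s.u t) x‖) ∧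
      (∀ t ∈ Icc 0 (S.τ j), Integrable fun x => (Δ (s.u t)) x) ∧
      (∀ t ∈ Icc 0 (S.τ j), Integrable fun x => cross x (curl (s.u t) x)) := by
  have hsub : Icc 0 (S.τ j) ⊆ Icc 0 (S.τ k) := Icc_subset_Icc le_rfl (S.τ_mono hj)
  have hU := uniqueDiffOn_slab S k
  -- pointwise consequences of D
  have hG1 : ∀ t ∈ Icc 0 (S.τ j), ∀ x, ‖curl (s.u t) x‖ ≤ G x ∧ ‖fderiv ℝ (curl (s.u t)) x‖ ≤ G x ∧
      ‖(Δ (curl (s.u t))) x‖ ≤ G x ∧ ‖x‖ * ‖curl (s.u t) x‖ ≤ G x ∧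
      ‖x‖ * ‖fderiv ℝ (curl (s.u t)) x‖ ≤ G x ∧ ‖x‖ * ‖(Δ (curl (s.u t))) x‖ ≤ G x := by
    intro t ht x
    have h := hD t ht x
    have h0 := norm_nonneg (curl (s.u t) x); have h1 := norm_nonneg (fderiv ℝ (curl (s.u t)) x)
    have h2 := norm_nonneg ((Δ (curl (s.u t))) x); have hx := norm_nonneg x
    refine ⟨?_, ?_, ?_, ?_, ?_, ?_⟩ <;> nlinarith
  -- the force majorants (n = 0, K = 4 and n = 1, K = 5)
  obtain ⟨C₀, hC₀, hF0⟩ := force_slice_bound S k 0 4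
  obtain ⟨C₁, hC₁, hF1⟩ := force_slice_bound S k 1 5
  have hw : ∀ x : EuclideanSpace ℝ (Fin 3), 0 < 1 + ‖x‖ := fun x => by positivity
  have hrp : ∀ (x : EuclideanSpace ℝ (Fin 3)) (K : ℕ), ((1 + ‖x‖) ^ K)⁻¹ = (1 + ‖x‖) ^ (-(K : ℝ)) :=
    fun x K => by rw [Real.rpow_neg (hw x).le, Real.rpow_natCast]
  have hf0 : ∀ t ∈ Icc 0 (S.τ k), ∀ x, ‖S.f t x‖ ≤ C₀ * (1 + ‖x‖) ^ (-(4 : ℝ)) := by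
    intro t ht x
    have h := hF0 t ht x
    rw [norm_iteratedFDeriv_zero] at h
    rw [show (-(4 : ℝ)) = -((4 : ℕ) : ℝ) by norm_num, ← hrp x 4, ← div_eq_mul_inv,
      le_div_iff₀ (by positivity)]
    linarith [mul_comm ((1 + ‖x‖) ^ 4) ‖S.f t x‖]
  have hf1 : ∀ t ∈ Icc 0 (S.τ k), ∀ x, ‖x‖ * ‖curl (S.f t) x‖ ≤ (‖curlCLM‖ * C₁) * (1 + ‖x‖) ^ (-(4 : ℝ)) := by
    intro t ht x
    have h := hF1 t ht x
    rw [← norm_iteratedFDeriv_fderiv (n := 0), norm_iteratedFDeriv_zero] at h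
    -- `(1+|x|)^5 ‖Df‖ ≤ C₁` ⇒ `|x| ‖Df‖ ≤ C₁ (1+|x|)^{-4}`
    have h5 : (1 + ‖x‖) ^ 5 = (1 + ‖x‖) ^ 4 * (1 + ‖x‖) := by ring
    have hDf : ‖x‖ * ‖fderiv ℝ (S.f t) x‖ ≤ C₁ * (1 + ‖x‖) ^ (-(4 : ℝ)) := by
      rw [show (-(4 : ℝ)) = -((4 : ℕ) : ℝ) by norm_num, ← hrp x 4, ← div_eq_mul_inv,
        le_div_iff₀ (by positivity)]
      have hx1 : ‖x‖ ≤ 1 + ‖x‖ := by linarith [norm_nonneg x]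
      calc ‖x‖ * ‖fderiv ℝ (S.f t) x‖ * (1 + ‖x‖) ^ 4
          ≤ (1 + ‖x‖) * ‖fderiv ℝ (S.f t) x‖ * (1 + ‖x‖) ^ 4 := by gcongr
        _ = (1 + ‖x‖) ^ 5 * ‖fderiv ℝ (S.f t) x‖ := by ring
        _ ≤ C₁ := h
    calc ‖x‖ * ‖curl (S.f t) x‖ ≤ ‖x‖ * (‖curlCLM‖ * ‖fderiv ℝ (S.f t) x‖) := by
          gcongr; exact norm_curl_le_opNorm_mul _ _
      _ = ‖curlCLM‖ * (‖x‖ * ‖fderiv ℝ (S.f t) x‖) := by ring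
      _ ≤ ‖curlCLM‖ * (C₁ * (1 + ‖x‖) ^ (-(4 : ℝ))) := by gcongr
      _ = (‖curlCLM‖ * C₁) * (1 + ‖x‖) ^ (-(4 : ℝ)) := by ring
  -- the velocity and gradient ceilings on the slab
  obtain ⟨L, hL0, hL⟩ := s.exists_norm_fderiv_le hν
  set U : ℝ := S.c₂ * R.Y k with hUdef
  have hUu : ∀ t ∈ Icc 0 (S.τ k), ∀ x, ‖s.u t x‖ ≤ U := fun t ht x => s.norm_le_ceiling_top ht x
  have hU0 : 0 ≤ U := (norm_nonneg _).trans (hUu 0 ⟨le_rfl, (S.τ_pos k).le⟩ 0)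
  -- the two majorants
  set F : EuclideanSpace ℝ (Fin 3) → ℝ := fun x => C₀ * (1 + ‖x‖) ^ (-(4 : ℝ)) with hFdef
  set g : EuclideanSpace ℝ (Fin 3) → ℝ :=
    fun x => (|ν| + U + L) * G x + (‖curlCLM‖ * C₁) * (1 + ‖x‖) ^ (-(4 : ℝ)) with hgdef
  have hFint : Integrable F := integrable_one_add_norm_neg_four.const_mul C₀
  have hgint : Integrable g :=
    (hG.const_mul _).add (integrable_one_add_norm_neg_four.const_mul _)
  refine ⟨F, g, hFint, hgint, fun t ht x => hf0 t (hsub ht) x, fun t ht x => ?_, fun t ht =>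
    integrable_norm_sq_slice s (hsub ht), fun t ht => integrable_norm_mul_norm_fderiv_slice hν s (hsub ht),
    fun t ht => ?_, fun t ht => ?_⟩
  · -- the majorant of `x × ∂ₜω`
    obtain ⟨hω, hDω, hΔω, hxω, hxDω, hxΔω⟩ := hG1 t ht x
    have hG0 : 0 ≤ G x := (norm_nonneg _).trans hω
    have hrate := timeDerivWithin_vorticity_eq s (hsub ht) x
    have e1 : ‖ν • (Δ (curl (s.u t))) x‖ = |ν| * ‖(Δ (curl (s.u t))) x‖ := by
      rw [norm_smul, Real.norm_eq_abs]
    have e2 : ‖convect (s.u t) (curl (s.u t)) x‖ ≤ ‖fderiv ℝ (curl (s.u t)) x‖ * U := by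
      rw [convect_apply]
      exact ((fderiv ℝ (curl (s.u t)) x).le_opNorm _).trans (by gcongr; exact hUu t (hsub ht) x)
    have e3 : ‖convect (curl (s.u t)) (s.u t) x‖ ≤ L * ‖curl (s.u t) x‖ := by
      rw [convect_apply]
      exact ((fderiv ℝ (s.u t) x).le_opNorm _).trans (by gcongr; exact hL t (hsub ht) x)
    have e4 := hf1 t (hsub ht) x
    calc ‖cross x (timeDerivWithin (Icc 0 (S.τ k)) (vorticity s.u) t x)‖
        ≤ ‖x‖ * ‖timeDerivWithin (Icc 0 (S.τ k)) (vorticity s.u) t x‖ := norm_cross_le_norm_mul_norm _ _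
      _ ≤ ‖x‖ * (|ν| * ‖(Δ (curl (s.u t))) x‖ + ‖fderiv ℝ (curl (s.u t)) x‖ * U
            + L * ‖curl (s.u t) x‖ + ‖curl (S.f t) x‖) := by
          rw [hrate]
          gcongr
          refine (norm_add_le _ _).trans (add_le_add ((norm_add_le _ _).trans (add_le_add
            ((norm_sub_le _ _).trans (add_le_add (le_of_eq e1) e2)) e3)) le_rfl)
      _ = |ν| * (‖x‖ * ‖(Δ (curl (s.u t))) x‖) + U * (‖x‖ * ‖fderiv ℝ (curl (s.u t)) x‖)
            + L * (‖x‖ * ‖curl (s.u t) x‖) + ‖x‖ * ‖curl (S.f t) x‖ := by ring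
      _ ≤ |ν| * G x + U * G x + L * G x + (‖curlCLM‖ * C₁) * (1 + ‖x‖) ^ (-(4 : ℝ)) := by
          gcongr
      _ = g x := by rw [hgdef]; ring
  · -- `Δu = -curl ω ∈ L¹`
    have ht' := hsub ht
    have hu2 : ContDiff ℝ 2 (s.u t) := (s.contDiff_slice ht').of_le (by norm_cast)
    have hΔc : Continuous fun x => (Δ (s.u t)) x :=
      ((s.classical.smooth_velocity.laplacian hU).contDiff_slice ht').continuous
    refine (hG.const_mul ‖curlCLM‖).mono' hΔc.aestronglyMeasurable (Eventually.of_forall fun x => ?_)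
    rw [laplacian_eq_neg_curl_curl hu2 (s.classical.divFree t ht') x, norm_neg]
    calc ‖curl (curl (s.u t)) x‖ ≤ ‖curlCLM‖ * ‖fderiv ℝ (curl (s.u t)) x‖ := norm_curl_le_opNorm_mul _ _
      _ ≤ ‖curlCLM‖ * G x := by gcongr; exact (hG1 t ht x).2.1
  · -- `x × ω ∈ L¹`
    have ht' := hsub ht
    have hωc : Continuous (curl (s.u t)) :=
      continuous_curl ((s.contDiff_slice ht').of_le (by norm_cast))
    refine hG.mono' ?_ (Eventually.of_forall fun x => ?_)
    · exact (crossCLM.continuous₂.comp (continuous_id.prodMk hωc)).aestronglyMeasurable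
    · exact (norm_cross_le_norm_mul_norm _ _).trans (hG1 t ht x).2.2.2.1

/-! ## §3 The impulse ledger of a registered stage -/

/-- **THE IMPULSE LEDGER OF A REGISTERED STAGE** (Saffman (3.2.9) on the register). For every stage
`s : Stage ν R S m k` (`ν > 0`; any rates, schedule, margins, level) and every readout `j ≤ k`, under the decay
hypothesis D(j) — `(1+|x|)(|ω| + |∇ω| + |Δω|)(t,x) ≤ G(x)`, `G ∈ L¹`, for all `t ∈ [0, τ_j]` — the impulse
density at the readout integrates to TWICE THE TOTAL PUSH: `∫ x × ω(τ_j, x) dx = 2 ∫₀^{τ_j} ∫ S.f(t, x) dx dt`.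
The ledger opens at zero (Clay datum: `∫ x × ω(0) = 0`, `integral_cross_curl_eq_zero_of_isDivFree`); viscosity and
transport never enter. [cite: Saffman1992, §3.2 eqs. (3.2.8), (3.2.9), (3.2.13)] -/
theorem integral_cross_curl_slice_eq_two_smul (hν : 0 < ν) (s : Stage ν R S m k) {j : ℕ} (hj : j ≤ k)
    {G : EuclideanSpace ℝ (Fin 3) → ℝ} (hG : Integrable G)
    (hD : ∀ t ∈ Icc 0 (S.τ j), ∀ x, (1 + ‖x‖) * (‖curl (s.u t) x‖ + ‖fderiv ℝ (curl (s.u t)) x‖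
      + ‖(Δ (curl (s.u t))) x‖) ≤ G x) :
    ∫ x, cross x (curl (s.u (S.τ j)) x) = (2 : ℝ) • ∫ t in (0 : ℝ)..S.τ j, ∫ x, S.f t x := by
  obtain ⟨F, g, hF, hg, hfF, hIg, h2, hprod, hΔ, hω⟩ := impulse_hypotheses hν s hj hG hD
  have hsub : Icc 0 (S.τ j) ⊆ Icc 0 (S.τ k) := Icc_subset_Icc le_rfl (S.τ_mono hj)
  have h0j : (0 : ℝ) ∈ Icc 0 (S.τ j) := ⟨le_rfl, (S.τ_pos j).le⟩
  have hjj : S.τ j ∈ Icc 0 (S.τ j) := ⟨(S.τ_pos j).le, le_rfl⟩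
  have hlaw := s.classical.integral_cross_vorticity_sub_eq (uniqueDiffOn_slab S k)
    (slab_subset_closure_interior S k) (S.τ_pos j).le hsub h2 hprod hΔ hF hfF hg hIg (hω 0 h0j)
    (hω _ hjj)
  -- the ledger opens at zero: the Clay datum has zero impulse
  have h0k : (0 : ℝ) ∈ Icc 0 (S.τ k) := hsub h0j
  have hu1 : ContDiff ℝ 1 (s.u 0) := (s.contDiff_slice h0k).of_le (by norm_cast)
  have hI0 : ∫ x, cross x (curl (s.u 0) x) = 0 :=
    integral_cross_curl_eq_zero_of_isDivFree hu1 (s.classical.divFree 0 h0k)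
      (s.hasRapidSpatialDecay_zero.integrable hu1.continuous) (hω 0 h0j)
  rw [hI0, sub_zero] at hlaw
  exact hlaw

/-- **THE AXIAL IMPULSE LEDGER** (third component, the tree's `swirl ω = (x × ω)₃ = x₀ω₁ − x₁ω₀`):
`∫ swirl ω(τ_j) dx = 2 ∫₀^{τ_j} ∫ f₃ dx dt` for every registered stage under D(j). For an axisymmetric slice
`swirl ω = r²·(ω_θ/r)`, so the left side is `2 I₃`, twice Saffman's axial impulse.
[cite: Saffman1992, §3.2 eqs. (3.2.8), (3.2.9)] -/
theorem integral_swirl_curl_slice_eq_two_mul (hν : 0 < ν) (s : Stage ν R S m k) {j : ℕ} (hj : j ≤ k)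
    {G : EuclideanSpace ℝ (Fin 3) → ℝ} (hG : Integrable G)
    (hD : ∀ t ∈ Icc 0 (S.τ j), ∀ x, (1 + ‖x‖) * (‖curl (s.u t) x‖ + ‖fderiv ℝ (curl (s.u t)) x‖
      + ‖(Δ (curl (s.u t))) x‖) ≤ G x) :
    ∫ x, swirl (curl (s.u (S.τ j))) x = 2 * ∫ t in (0 : ℝ)..S.τ j, ∫ x, S.f t x 2 := by
  obtain ⟨F, g, hF, hg, hfF, hIg, h2, hprod, hΔ, hω⟩ := impulse_hypotheses hν s hj hG hD
  have hsub : Icc 0 (S.τ j) ⊆ Icc 0 (S.τ k) := Icc_subset_Icc le_rfl (S.τ_mono hj)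
  have h0j : (0 : ℝ) ∈ Icc 0 (S.τ j) := ⟨le_rfl, (S.τ_pos j).le⟩
  have hjj : S.τ j ∈ Icc 0 (S.τ j) := ⟨(S.τ_pos j).le, le_rfl⟩
  have hlaw := s.classical.integral_swirl_vorticity_sub_eq (uniqueDiffOn_slab S k)
    (slab_subset_closure_interior S k) (S.τ_pos j).le hsub h2 hprod hΔ hF hfF hg hIg (hω 0 h0j)
    (hω _ hjj)
  have h0k : (0 : ℝ) ∈ Icc 0 (S.τ k) := hsub h0j
  have hu1 : ContDiff ℝ 1 (s.u 0) := (s.contDiff_slice h0k).of_le (by norm_cast)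
  have hI0 : ∫ x, swirl (curl (s.u 0)) x = 0 :=
    integral_swirl_curl_eq_zero_of_isDivFree hu1 (s.classical.divFree 0 h0k)
      (s.hasRapidSpatialDecay_zero.integrable hu1.continuous) (by
        have e : (fun x => swirl (curl (s.u 0)) x) = fun x => cross x (curl (s.u 0) x) 2 := by
          funext x; simp [cross, cross_apply, swirl]
        rw [e]
        exact (EuclideanSpace.proj (2 : Fin 3) : EuclideanSpace ℝ (Fin 3) →L[ℝ] ℝ).integrable_comp
          (hω 0 h0j))
  rw [hI0, sub_zero] at hlaw
  exact hlaw

/-! ## §4 Signed swirl-free readout slices were pushed with positive axial mean -/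

/-- **A REGISTERED STAGE WHOSE `τ_j`-SLICE IS SIGNED SWIRL-FREE WAS PUSHED WITH POSITIVE TOTAL AXIAL MEAN**:
for every stage (`ν > 0`; any rates, schedule, margins, level), every `j ≤ k`, under D(j): if the `τ_j`-slice is
a single-signed swirl-free axisymmetric field (`SignedNoSwirlSlice`), then `0 < ∫₀^{τ_j} ∫ (S.f t x)₃ dx dt`.
Reason: the slice carries the positive axial impulse `½∫r²(ω_θ/r) > 0` (g7,
`integral_cylRadius_sq_mul_angVortQuot_pos_of_signedNoSwirlSlice`), `swirl ω = r²(ω_θ/r)` for axisymmetric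
fields, and the ledger `∫ swirl ω(τ_j) = 2∫∫f₃`. [cite: Saffman1992, §3.2 eqs. (3.2.8), (3.2.9)] -/
theorem integral_force_axial_pos_of_signedNoSwirlSlice (hν : 0 < ν) (s : Stage ν R S m k) {j : ℕ}
    (hj : j ≤ k) {G : EuclideanSpace ℝ (Fin 3) → ℝ} (hG : Integrable G)
    (hD : ∀ t ∈ Icc 0 (S.τ j), ∀ x, (1 + ‖x‖) * (‖curl (s.u t) x‖ + ‖fderiv ℝ (curl (s.u t)) x‖
      + ‖(Δ (curl (s.u t))) x‖) ≤ G x)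
    {M : ℝ} (hsl : SignedNoSwirlSlice (s.u (S.τ j)) M) :
    0 < ∫ t in (0 : ℝ)..S.τ j, ∫ x, S.f t x 2 := by
  have hpos := integral_cylRadius_sq_mul_angVortQuot_pos_of_signedNoSwirlSlice s hj hsl
  have hv3 : ContDiff ℝ 3 (s.u (S.τ j)) :=
    (s.contDiff_slice (τ_mem_Icc S hj)).of_le (by norm_cast)
  have hdict := hsl.axisym.swirl_curl_eq_cylRadius_sq_mul_angVortQuot hv3
  have hlaw := integral_swirl_curl_slice_eq_two_mul hν s hj hG hD
  rw [hdict] at hlaw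
  -- `0 < ∫ r²η = 2 ∫∫ f₃`
  linarith

/-- Contrapositive, impulse form: a registered stage all of whose push has NON-POSITIVE total axial mean on
`[0, τ_j]` (e.g. every design whose force has ZERO spatial mean at each time — `curl`-type pushes) has NO signed
swirl-free `τ_j`-slice (under D(j)). [cite: Saffman1992, §3.2 eqs. (3.2.8), (3.2.9)] -/
theorem not_signedNoSwirlSlice_of_integral_force_axial_nonpos (hν : 0 < ν) (s : Stage ν R S m k) {j : ℕ}
    (hj : j ≤ k) {G : EuclideanSpace ℝ (Fin 3) → ℝ} (hG : Integrable G)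
    (hD : ∀ t ∈ Icc 0 (S.τ j), ∀ x, (1 + ‖x‖) * (‖curl (s.u t) x‖ + ‖fderiv ℝ (curl (s.u t)) x‖
      + ‖(Δ (curl (s.u t))) x‖) ≤ G x)
    (hmean : ∫ t in (0 : ℝ)..S.τ j, ∫ x, S.f t x 2 ≤ 0) (M : ℝ) :
    ¬ SignedNoSwirlSlice (s.u (S.τ j)) M := fun hsl =>
  absurd hmean (not_le.2 (integral_force_axial_pos_of_signedNoSwirlSlice hν s hj hG hD hsl))

/-- **Zero-mean pushes** (the common case): if `∫ S.f(t, x) dx = 0` for every `t ∈ [0, τ_j]`, the total axial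
mean vanishes, so no signed swirl-free `τ_j`-slice (under D(j)). [cite: Saffman1992, §3.2 eq. (3.2.9)] -/
theorem not_signedNoSwirlSlice_of_zeroMean (hν : 0 < ν) (s : Stage ν R S m k) {j : ℕ}
    (hj : j ≤ k) {G : EuclideanSpace ℝ (Fin 3) → ℝ} (hG : Integrable G)
    (hD : ∀ t ∈ Icc 0 (S.τ j), ∀ x, (1 + ‖x‖) * (‖curl (s.u t) x‖ + ‖fderiv ℝ (curl (s.u t)) x‖
      + ‖(Δ (curl (s.u t))) x‖) ≤ G x)
    (hzero : ∀ t ∈ Icc 0 (S.τ j), ∫ x, S.f t x = 0) (M : ℝ) :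
    ¬ SignedNoSwirlSlice (s.u (S.τ j)) M := by
  refine not_signedNoSwirlSlice_of_integral_force_axial_nonpos hν s hj hG hD (le_of_eq ?_) M
  rw [intervalIntegral.integral_of_le (S.τ_pos j).le]
  refine setIntegral_eq_zero_of_forall_eq_zero fun t ht => ?_
  have ht' : t ∈ Icc 0 (S.τ j) := Ioc_subset_Icc_self ht
  -- `∫ f₃ = (∫ f)₃ = 0` (the slice is integrable: Schwartz majorant)
  obtain ⟨C₀, -, hF0⟩ := force_slice_bound S k 0 4
  have hsub : Icc 0 (S.τ j) ⊆ Icc 0 (S.τ k) := Icc_subset_Icc le_rfl (S.τ_mono hj)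
  have hfc : Continuous (S.f t) := ((isSmoothSpaceTimeOn_force_slab S k).contDiff_slice (hsub ht')).continuous
  have hfi : Integrable (S.f t) := by
    refine (integrable_one_add_norm_neg_four.const_mul C₀).mono' hfc.aestronglyMeasurable
      (Eventually.of_forall fun x => ?_)
    have h := hF0 t (hsub ht') x
    rw [norm_iteratedFDeriv_zero] at h
    have hw : 0 < 1 + ‖x‖ := by positivity
    rw [show (-(4 : ℝ)) = -((4 : ℕ) : ℝ) by norm_num, Real.rpow_neg hw.le, Real.rpow_natCast,
      ← div_eq_mul_inv, le_div_iff₀ (by positivity)]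
    linarith [mul_comm ((1 + ‖x‖) ^ 4) ‖S.f t x‖]
  have e : (∫ x, S.f t x) 2 = 0 := by rw [hzero t ht']; simp
  rw [integral_apply_fin_three hfi] at e
  exact e

end Register

end Summit.NavierStokesRegularity.HeredityAtOneImpulseBalance

end
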